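import Summits.CriticalPhenomena.PercolationContinuityZ3.Theorems.PercNearOneGluingNoHeavyLowerTailSahiGridPatternCoLiftPrelim

/-!
# `NoHeavyLowerTail` (crux stmt-CriticalPhenomena-4575), Sahi programme: TWO-AXIS SLICING of the pattern-functional atoms

Support file (seat `prim-sahi-p1`, generation 9; `--supports stmt-CriticalPhenomena-4575`).  Pure proofs, no definitions, no `sorry`,
standard axioms.  After the one-axis block expansion `block_eq` (27 level blocks of `(n+1)`-dimensional atoms), a certificate that lives on
the CELLS of two axes needs each `(n+1)`-dimensional atom sliced once more along the last axis of `[3]^{n+1}`: `sliceT` (triple-point count),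
`sliceN` (pair count with the totally-distinct kernel: levels must differ), `sliceL` (Latin count: the third point's level is `-(l'+l'')`),
plus the bookkeeping `ind_snoc_filter`, `filter_snoc_filter`, `thirdPt_snoc`, cell up-set / nesting facts.  Used by `…SahiGridPatternTwoJunta`
(every up-set of two coordinates, times `[3]^n`, is a good first slot). [this work]
-/

namespace Summit.CriticalPhenomena.PercolationContinuityZ3.Theorems.SahiGridPattern

open Finset SahiGrid3
open scoped BigOperators

variable {n : ℕ}

/-- Indicator of a slice. [this work] -/
theorem ind_snoc_filter (X : Finset (Pd (n + 1))) (q : Pd n) (l : Fin 3) :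
    ind X (Fin.snoc q l : Pd (n + 1)) = ind (univ.filter fun q : Pd n => (Fin.snoc q l : Pd (n + 1)) ∈ X) q := by
  unfold ind; simp

/-- A slice of a slice is a cell. [this work] -/
theorem filter_snoc_filter (A : Finset (Pd (n + 2))) (l i : Fin 3) :
    (univ.filter fun q : Pd n => (Fin.snoc q l : Pd (n + 1)) ∈ (univ.filter fun p : Pd (n + 1) => (Fin.snoc p i : Pd (n + 2)) ∈ A)) =
      univ.filter fun q : Pd n => (Fin.snoc (Fin.snoc q l : Pd (n + 1)) i : Pd (n + 2)) ∈ A := by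
  ext q; simp

/-- The indicator of the empty set vanishes. [this work] -/
theorem ind_empty' {α : Type*} [DecidableEq α] (x : α) : ind (∅ : Finset α) x = 0 := by
  unfold ind; simp

/-- The third point of two `snoc` points. [this work] -/
theorem thirdPt_snoc (q r : Pd n) (l l' : Fin 3) :
    thirdPt (Fin.snoc q l : Pd (n + 1)) (Fin.snoc r l') = Fin.snoc (thirdPt q r) (-(l + l')) := by
  funext a
  refine Fin.lastCases ?_ (fun b => ?_) a
  · simp [thirdPt, Fin.snoc_last]
  · simp [thirdPt, Fin.snoc_castSucc]

/-- The totally-distinct kernel on `snoc` points. [this work] -/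
theorem delta_snoc (p q : Pd n) (l l' : Fin 3) :
    (if TotDist (Fin.snoc p l : Pd (n + 1)) (Fin.snoc q l') = true then (1:ℤ) else 0) =
      (if l = l' then (0:ℤ) else 1) * (if TotDist p q = true then (1:ℤ) else 0) := by
  by_cases h : TotDist (Fin.snoc p l : Pd (n + 1)) (Fin.snoc q l') = true
  · rw [if_pos h]
    rw [totDist_snoc_iff] at h
    rw [if_neg h.2, if_pos h.1]; ring
  · rw [if_neg h]
    rw [totDist_snoc_iff, not_and_or] at h
    rcases h with h | h
    · rw [if_neg h]; ring
    · rw [not_not] at h; rw [if_pos h]; ring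

/-- **Slicing the triple-point atom.** [this work] -/
theorem sliceT (X Y Z : Finset (Pd (n + 1))) :
    (∑ p, ind X p * ind Y p * ind Z p) =
      ∑ l : Fin 3, ∑ q : Pd n, ind (univ.filter fun q : Pd n => (Fin.snoc q l : Pd (n + 1)) ∈ X) q *
        ind (univ.filter fun q : Pd n => (Fin.snoc q l : Pd (n + 1)) ∈ Y) q * ind (univ.filter fun q : Pd n => (Fin.snoc q l : Pd (n + 1)) ∈ Z) q := by
  rw [sum_snoc]
  refine Finset.sum_congr rfl fun l _ => Finset.sum_congr rfl fun q _ => ?_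
  rw [ind_snoc_filter, ind_snoc_filter, ind_snoc_filter]

/-- **Slicing the pair-count atom** (first point in `X`, second in `Y ∩ Z`, totally distinct): the two levels must differ. [this work] -/
theorem sliceN (X Y Z : Finset (Pd (n + 1))) :
    (∑ p, ∑ q, ind X p * ind Y q * ind Z q * (if TotDist p q = true then (1:ℤ) else 0)) =
      ∑ l : Fin 3, ∑ l' : Fin 3, (if l = l' then (0:ℤ) else 1) *
        ∑ p : Pd n, ∑ q : Pd n, ind (univ.filter fun q : Pd n => (Fin.snoc q l : Pd (n + 1)) ∈ X) p *
          ind (univ.filter fun q : Pd n => (Fin.snoc q l' : Pd (n + 1)) ∈ Y) q *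
          ind (univ.filter fun q : Pd n => (Fin.snoc q l' : Pd (n + 1)) ∈ Z) q * (if TotDist p q = true then (1:ℤ) else 0) := by
  rw [sum_snoc]
  refine Finset.sum_congr rfl fun l _ => ?_
  have e : ∀ p : Pd n, (∑ q : Pd (n + 1), ind X (Fin.snoc p l : Pd (n + 1)) * ind Y q * ind Z q *
      (if TotDist (Fin.snoc p l : Pd (n + 1)) q = true then (1:ℤ) else 0)) =
      ∑ l' : Fin 3, ∑ q : Pd n, (if l = l' then (0:ℤ) else 1) *
        (ind (univ.filter fun q : Pd n => (Fin.snoc q l : Pd (n + 1)) ∈ X) p *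
          ind (univ.filter fun q : Pd n => (Fin.snoc q l' : Pd (n + 1)) ∈ Y) q *
          ind (univ.filter fun q : Pd n => (Fin.snoc q l' : Pd (n + 1)) ∈ Z) q * (if TotDist p q = true then (1:ℤ) else 0)) := by
    intro p
    rw [sum_snoc]
    refine Finset.sum_congr rfl fun l' _ => Finset.sum_congr rfl fun q _ => ?_
    rw [ind_snoc_filter X, ind_snoc_filter Y, ind_snoc_filter Z, delta_snoc]; ring
  simp_rw [e]
  rw [Finset.sum_comm]
  refine Finset.sum_congr rfl fun l' _ => ?_
  rw [Finset.mul_sum]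
  refine Finset.sum_congr rfl fun p _ => ?_
  rw [Finset.mul_sum]

/-- **Slicing the Latin atom** (points in `Y`, `Z` at different levels `l', l''`, third point in `X` at level `-(l'+l'')`). [this work] -/
theorem sliceL (X Y Z : Finset (Pd (n + 1))) :
    (∑ q, ∑ r, ind Y q * ind Z r * ind X (thirdPt q r) * (if TotDist q r = true then (1:ℤ) else 0)) =
      ∑ l' : Fin 3, ∑ l'' : Fin 3, (if l' = l'' then (0:ℤ) else 1) *
        ∑ q : Pd n, ∑ r : Pd n, ind (univ.filter fun q : Pd n => (Fin.snoc q l' : Pd (n + 1)) ∈ Y) q *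
          ind (univ.filter fun q : Pd n => (Fin.snoc q l'' : Pd (n + 1)) ∈ Z) r *
          ind (univ.filter fun q : Pd n => (Fin.snoc q (-(l' + l'')) : Pd (n + 1)) ∈ X) (thirdPt q r) *
          (if TotDist q r = true then (1:ℤ) else 0) := by
  rw [sum_snoc]
  refine Finset.sum_congr rfl fun l' _ => ?_
  have e : ∀ q : Pd n, (∑ r : Pd (n + 1), ind Y (Fin.snoc q l' : Pd (n + 1)) * ind Z r * ind X (thirdPt (Fin.snoc q l' : Pd (n + 1)) r) *
      (if TotDist (Fin.snoc q l' : Pd (n + 1)) r = true then (1:ℤ) else 0)) =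
      ∑ l'' : Fin 3, ∑ r : Pd n, (if l' = l'' then (0:ℤ) else 1) *
        (ind (univ.filter fun q : Pd n => (Fin.snoc q l' : Pd (n + 1)) ∈ Y) q *
          ind (univ.filter fun q : Pd n => (Fin.snoc q l'' : Pd (n + 1)) ∈ Z) r *
          ind (univ.filter fun q : Pd n => (Fin.snoc q (-(l' + l'')) : Pd (n + 1)) ∈ X) (thirdPt q r) *
          (if TotDist q r = true then (1:ℤ) else 0)) := by
    intro q
    rw [sum_snoc]
    refine Finset.sum_congr rfl fun l'' _ => Finset.sum_congr rfl fun r _ => ?_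
    rw [thirdPt_snoc, ind_snoc_filter Y, ind_snoc_filter Z, ind_snoc_filter X, delta_snoc]; ring
  simp_rw [e]
  rw [Finset.sum_comm]
  refine Finset.sum_congr rfl fun l'' _ => ?_
  rw [Finset.mul_sum]
  refine Finset.sum_congr rfl fun q _ => ?_
  rw [Finset.mul_sum]

/-- A cell of an up-set (two last coordinates fixed) is an up-set. [this work] -/
theorem isUpperSet_cell {B : Finset (Pd (n + 2))} (hB : IsUpperSet (B : Set (Pd (n + 2)))) (l i : Fin 3) :
    IsUpperSet ((univ.filter fun q : Pd n => (Fin.snoc (Fin.snoc q l : Pd (n + 1)) i : Pd (n + 2)) ∈ B : Finset (Pd n)) : Set (Pd n)) := by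
  rw [← filter_snoc_filter]
  exact isUpperSet_filter_snoc (isUpperSet_filter_snoc hB i) l

/-- Cells of an up-set are nested along both cell coordinates. [this work] -/
theorem cell_subset {B : Finset (Pd (n + 2))} (hB : IsUpperSet (B : Set (Pd (n + 2)))) {l l' i i' : Fin 3} (hl : l ≤ l') (hi : i ≤ i') :
    (univ.filter fun q : Pd n => (Fin.snoc (Fin.snoc q l : Pd (n + 1)) i : Pd (n + 2)) ∈ B) ⊆
      univ.filter fun q : Pd n => (Fin.snoc (Fin.snoc q l' : Pd (n + 1)) i' : Pd (n + 2)) ∈ B := by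
  intro q hq
  rw [Finset.mem_filter] at hq ⊢
  refine ⟨Finset.mem_univ _, hB ?_ hq.2⟩
  exact le_trans (snoc_le_snoc_of_le_left (snoc_le_snoc_of_le q hl) i) (snoc_le_snoc_of_le _ hi)

/-- Values of the level kernel `[l ≠ l']` and of the Latin level `-(l'+l'')` on `Fin 3` (for `simp only`). [this work] -/
theorem fin3_tables :
    ((if (0:Fin 3) = 0 then (0:ℤ) else 1) = 0 ∧ (if (1:Fin 3) = 1 then (0:ℤ) else 1) = 0 ∧ (if (2:Fin 3) = 2 then (0:ℤ) else 1) = 0 ∧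
     (if (0:Fin 3) = 1 then (0:ℤ) else 1) = 1 ∧ (if (0:Fin 3) = 2 then (0:ℤ) else 1) = 1 ∧ (if (1:Fin 3) = 0 then (0:ℤ) else 1) = 1 ∧
     (if (1:Fin 3) = 2 then (0:ℤ) else 1) = 1 ∧ (if (2:Fin 3) = 0 then (0:ℤ) else 1) = 1 ∧ (if (2:Fin 3) = 1 then (0:ℤ) else 1) = 1) ∧
    ((-((0:Fin 3) + 1)) = 2 ∧ (-((0:Fin 3) + 2)) = 1 ∧ (-((1:Fin 3) + 0)) = 2 ∧ (-((1:Fin 3) + 2)) = 0 ∧ (-((2:Fin 3) + 0)) = 1 ∧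
     (-((2:Fin 3) + 1)) = 0 ∧ (-((0:Fin 3) + 0)) = 0 ∧ (-((1:Fin 3) + 1)) = 1 ∧ (-((2:Fin 3) + 2)) = 2) := by
  refine ⟨⟨?_, ?_, ?_, ?_, ?_, ?_, ?_, ?_, ?_⟩, ?_⟩ <;> (try decide)

end Summit.CriticalPhenomena.PercolationContinuityZ3.Theorems.SahiGridPattern
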